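import Literature.MathematicalPhysics.QuantumFieldTheory.YangMillsOS
import HarnessLib

/-!
# `CriticalContinuumLimit` — line `Sketch`: a scheme riding a uniformly admissible rate has the
# crux's uniform lattice mass gap verbatim (stub `stub_latticeGap`)

Support file for crux `stmt-QuantumFields-8762`
(`Summit.QuantumFields.YangMills.Theses.EquipartitionCriticality.CriticalContinuumLimit`): this is stub
`stub_latticeGap` of line `Sketch` (skeleton `Cruxes/CriticalContinuumLimit/Lines/Sketch.lean`).

What (pure bookkeeping).  Suppose every pair of gauge-invariant local lattice observables `A, B` has a
volume-uniform exponential decay of its connected time-correlation at every coupling `β ≥ β₁`, on every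
periodic torus of side `2S+1` with `S ≥ S₀(β)` and at every time separation `n ≤ S`, at rate `m(β)`:
`|⟨A · τ_{n e₀} B⟩_{β,S} − ⟨A⟩_{β,S} ⟨B⟩_{β,S}| ≤ C e^{−m(β) n}` with `C = C(A, B)`.  Then along EVERY species
scheme `sch` whose couplings are eventually `≥ β₁`, whose spacings RIDE the rate at gap `Δ > 0`,
`a_k = m(β_k)/Δ`, and whose tori are eventually large, `S₀(β_k) ≤ L_k`, the tree clause
`HasLatticeMassGap r sch Δ` holds verbatim: for the pair `A, B` take the same constant `C`; for all large `k`
every torus `S ≥ L_k ≥ S₀(β_k)` and every `n ≤ S` is covered by the hypothesis at `β = β_k`, and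
`e^{−m(β_k) n} = e^{−Δ (a_k n)}` because `Δ · a_k = m(β_k)`.  No constant is lost and no reindexing of the
scheme is needed.  (Compare the `Δ = 1`, `S₀ = S₀(A, B)` variant
`HypercubicLimit.Negative.hasLatticeMassGap_of_allPairsDecay`.)
-/

noncomputable section

open MeasureTheory Filter Topology
open Literature.MathematicalPhysics.AQFT Literature.MathematicalPhysics.QuantumLattice
open Literature.MathematicalPhysics.QuantumFieldTheory

namespace Summit.QuantumFields.YangMills.Theorems.CriticalContinuumLimit

variable {G : Type} [Group G] [TopologicalSpace G] [IsTopologicalGroup G] [CompactSpace G]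
  [MeasurableSpace G] [BorelSpace G]

/-- **A scheme riding a uniformly admissible rate has the crux's uniform lattice mass gap.**  If every
pair of species `A, B` has the volume-uniform decay
`|latticeConnectedCorr r.ρ β (2S+1) A.F B.F n| ≤ C e^{−m(β) n}` for all `β ≥ β₁`, `S ≥ S₀(β)`, `n ≤ S`, then
every species scheme with couplings eventually in `[β₁, ∞)`, spacings `a_k = m(β_k)/Δ` (`Δ > 0`) and tori
eventually satisfying `S₀(β_k) ≤ L_k` has `HasLatticeMassGap r sch Δ`: same constant `C`, the hypothesis at
`β = β_k` covers every `S ≥ L_k` and `n ≤ S`, and `Δ (a_k n) = m(β_k) n`. [folklore] -/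
theorem stub_latticeGap (r : LatticeRep G) (β₁ : ℝ) (m : ℝ → ℝ) (S₀ : ℝ → ℕ) (Δ : ℝ) (hΔ : 0 < Δ)
    (hdec : ∀ A B : YMSpecies G, ∃ C : ℝ, ∀ β : ℝ, β₁ ≤ β → ∀ S n : ℕ, S₀ β ≤ S → n ≤ S →
      |latticeConnectedCorr r.ρ β (2 * S + 1) A.F B.F n| ≤ C * Real.exp (-(m β * n)))
    (sch : SpeciesScheme (YMSpecies G)) (hβ : ∀ᶠ k in atTop, β₁ ≤ sch.β k)
    (ha : ∀ k, sch.a k = m (sch.β k) / Δ) (hL : ∀ᶠ k in atTop, S₀ (sch.β k) ≤ sch.L k) :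
    HasLatticeMassGap r sch Δ := by
  intro A B
  obtain ⟨C, h⟩ := hdec A B
  refine ⟨C, ?_⟩
  filter_upwards [hβ, hL] with k hkβ hkL S hS n hn
  have hmul : Δ * (sch.a k * n) = m (sch.β k) * n := by
    rw [ha k, ← mul_assoc, mul_div_cancel₀ _ hΔ.ne']
  rw [hmul]
  exact h (sch.β k) hkβ S n (hkL.trans hS) hn

end Summit.QuantumFields.YangMills.Theorems.CriticalContinuumLimit

end
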